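import Summits.Langlands.Langlands.Theses.DedekindQuotient1951
import Summits.Langlands.Langlands.Theorems.DedekindQuotient1951DedekindQuotientEntireStubSatakeFactor
import Summits.Langlands.Langlands.Theorems.DedekindQuotient1951DedekindQuotientEntireStubDedekindEulerRegroup
import Summits.Langlands.Langlands.Theorems.DedekindQuotient1951DedekindQuotientEntireStubCompleteThenMultiply
import Summits.Langlands.Langlands.Theorems.DedekindQuotient1951DedekindQuotientEntireStubPiSide
import HarnessLib

/-!
# Route `DedekindQuotient1951` (Langlands) — crux `DedekindQuotientEntire` (stmt-Langlands-17271)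

Typed reciprocity at `n = 4` plus the Godement–Jacquet input `PartialLEntire` (the antecedent)
imply Dedekind's conjecture on `Re s > 0` for the number field `K` of the Frobenius–splitting
hypothesis: there is `g` holomorphic on `Re s > 0` with `g·ζ = ζ_K` on `Re s > 1`.

This file is the COMPOSITION of line `Sketch` over its four landed stubs (all in namespace
`Summit.Langlands.Langlands.Theorems.DedekindQuotientEntire`):

* stub A `stub_satakeFactor_eq_splittingType` (two evaluations of the Frobenius polynomial
  identity: `(1 - y)·∏_{a ∈ α}(1 - a y) = ∏_{f ∈ splittingType K q}(1 - y^f)`);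
* stub B `stub_hasProd_primes_dedekindZeta` (`ζ_K` Euler product regrouped along the rational
  primes, `Re s > 1`);
* stub C `stub_completeThenMultiply` (complete the partial product by its finite part, multiply by
  the Euler product of `ζ`, identity principle on `Re s > 1`);
* stub D `stub_piSide` (cofinite Satake clause of `Corresponds` + Frobenius hypothesis +
  uniqueness of Frobenius characteristic polynomials + `PartialLEntire` at `n = 4`, transported to
  `Nat.Primes`).

The hypothesis `π.1.IsLAlgebraic` and the local–global half of `Corresponds` are not used
(refuter ATTACK.md mutation note); the reciprocity datum `RD` enters only through `Corresponds`.
-/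

set_option linter.dupNamespace false

noncomputable section

open scoped NumberField
open Polynomial Complex Filter IsDedekindDomain
open Literature.NumberTheory.NumberFields Literature.NumberTheory.Automorphic
open Literature.NumberTheory.GaloisRepresentations

namespace Summit.Langlands.Langlands.Theorems

/-- **Crux `DedekindQuotientEntire` of route `DedekindQuotient1951`** (stmt-Langlands-17271):
given the Godement–Jacquet input (`PartialLEntire`, the antecedent), for every number field `K`,
reciprocity datum `RD`, prime `ℓ`, `ι : ℚ̄_ℓ ≃ ℂ`, cuspidal `π` of `GL₄(𝔸_ℚ)` and
`ρ : Γ_ℚ → GL₄(ℚ̄_ℓ)` unramified with `(X - 1)·charpoly(Frob_v) = ∏_{𝔭 ∣ q_v}(X^{f(𝔭)} - 1)` in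
`𝓞_K` at every `v` with `q_v ∉ {1951, ℓ}`, `Corresponds RD ι π ρ` implies that `ζ_K/ζ` is
holomorphic on `Re s > 0`: there is `g` holomorphic there with `g·ζ = ζ_K` on `Re s > 1`.
Proof: stub D (fed stub A as its local identity) gives a finite `T ⊆ Nat.Primes`, `σ₀` and an
entire `g₀` with `∏_{p ∉ T} ζ_{K,p}(s)(1 - p^{-s}) = g₀(s)` for `Re s > σ₀`; stub C (fed stub B as
the regrouped Euler product of `ζ_K`) completes and multiplies. -/
theorem DedekindQuotientEntire_of :
    Summit.Langlands.Langlands.Theses.DedekindQuotient1951.DedekindQuotientEntire := by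
  intro hS4 K _ _ RD ℓ _ ι hcpt π ρ hfrob _ hcorr
  obtain ⟨T, σ₀, g₀, hg₀, hprod⟩ :=
    DedekindQuotientEntire.stub_piSide hS4 K RD ℓ ι hcpt π ρ hfrob hcorr
      (fun hq α h y => DedekindQuotientEntire.stub_satakeFactor_eq_splittingType ι K hq α h y)
  exact DedekindQuotientEntire.stub_completeThenMultiply K T σ₀ g₀ hg₀ hprod
    (fun s hs => DedekindQuotientEntire.stub_hasProd_primes_dedekindZeta K hs)

end Summit.Langlands.Langlands.Theorems

end
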